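import Summits.QuantumFields.YangMills.Theorems.EquipartitionCriticalityFreeEnergyLogCoefficientExpChartMeasure
import Summits.QuantumFields.YangMills.Theorems.EquipartitionCriticalityFreeEnergyLogCoefficientStubFourProduct
import Summits.QuantumFields.YangMills.Theorems.LangevinControlUVFemtoCurvatureTwoPointStubDoublingOfRV
import Literature.MathematicalPhysics.QuantumFieldTheory.Balaban1983to89.B7Eq31BCH
import HarnessLib

/-!
# Second-order exponential chart package, parts (a) and (b): quadratic plaquette cost to `O(|a|⁴)`
# and Baker–Campbell–Hausdorff to second order in the chart

Support file for the stub `stub_expChartPackage2 : ColdBoxAllGroups.ExpChartPackage2` (support item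
stmt-QuantumFields-22893, shared stub D2 of crux `BoxFloorAllGroups` = stmt-QuantumFields-22254, line `birth`,
route `ColdBoxAllGroups` of `QuantumFields/YangMills`).

For a compact group `G` with a faithful continuous unitary representation `ρ : G →* M_N(ℂ)` and the tree's
exponential chart `ψ = expChart ρ : ℝ^D → G`, `ρ (ψ a) = exp (lieIso ρ a)` (`lieIso ρ` an isometry of `ℝ^D`
onto the Lie algebra `𝔤_ρ ⊆ 𝔲(N)` with its Hilbert–Schmidt norm), this file proves:

* `abs_quadCost_sub_le` — for a skew-Hermitian `X` with `‖X‖_F ≤ 1`,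
  `|N − Re tr e^X − ‖X‖²/2| ≤ (N/8)‖X‖⁴` (fourth-order Taylor remainder of `exp`, `Re tr X = Re tr X³ = 0`,
  `Re tr X² = −‖X‖²`); `abs_quadCost_expChart_sub_le` — the chart form
  `|N − Re tr ρ(ψ a) − ‖a‖²/2| ≤ (N/8)‖a‖⁴` for `‖a‖ ≤ 1`.
* `exists_bch_expChart` — there is `r₂ > 0` such that for `‖a‖, ‖b‖ ≤ r₂` there is `c` with
  `ψ a · ψ b = ψ c`, `‖c‖ ≤ 2(‖a‖ + ‖b‖)` and
  `‖lieIso c − (lieIso a + lieIso b + ½[lieIso a, lieIso b])‖_F ≤ 5(‖a‖ + ‖b‖)³`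
  (von Neumann's local surjectivity of the chart `exists_chart_radius`, the tree's
  `FemtoCurvatureTwoPoint.DoublingOfRV.norm_rho_mul_sub_one_le`, `log e^Z = Z` below `ln 2`
  (`B7BlockAvgLog.mlog_exp`) and Bałaban's printed second-order BCH bound `B7Eq31BCH.eq30_of_sum_le`).

References: S. Chatterjee, arXiv:1602.01222 §11; T. Bałaban, CMP 98 (1985) (30) p. 22; J. von Neumann (1929).
No claim about the Yang–Mills mass gap is made here (support lemma of a RECORD-label rung R2xi-G line).
-/

noncomputable section

open scoped Matrix Matrix.Norms.Frobenius Nat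
open NormedSpace (exp)
open Matrix (trace)
open Literature.MathematicalPhysics.QuantumFieldTheory
open Literature.MathematicalPhysics.QuantumFieldTheory.UnitaryCayley (re_trace_eq_zero_of_skew abs_re_trace_le
  neg_re_trace_sq_of_skew)
open Literature.MathematicalPhysics.QuantumFieldTheory.Balaban1983to89

namespace Summit.QuantumFields.YangMills.Theorems.ColdBoxAllGroups.ExpChart2

open Summit.QuantumFields.YangMills.Theorems.FreeEnergyLogCoefficient

variable {N : ℕ}

/-! ### (a) The quadratic cost to fourth order -/

/-- Fourth-order Taylor remainder of the matrix exponential in the Frobenius norm: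
`‖e^Y − 1 − Y − Y²/2 − Y³/6‖ ≤ ‖Y‖⁴ e^{‖Y‖} / 24`. [folklore] -/
theorem norm_exp_sub_four_le (Y : Matrix (Fin N) (Fin N) ℂ) :
    ‖exp Y - 1 - Y - (2 : ℂ)⁻¹ • (Y * Y) - (6 : ℂ)⁻¹ • (Y * Y * Y)‖ ≤ ‖Y‖ ^ 4 * Real.exp ‖Y‖ / 24 := by
  have h1 : HasSum (fun n => (n !⁻¹ : ℂ) • Y ^ n) (exp Y) := NormedSpace.exp_series_hasSum_exp' Y
  have h1' : HasSum (fun n => ((n + 4) !⁻¹ : ℂ) • Y ^ (n + 4))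
      (exp Y - 1 - Y - (2 : ℂ)⁻¹ • (Y * Y) - (6 : ℂ)⁻¹ • (Y * Y * Y)) := by
    have h := (hasSum_nat_add_iff' 4).mpr h1
    have hps : ∑ i ∈ Finset.range 4, ((i !⁻¹ : ℂ) • Y ^ i) =
        1 + Y + (2 : ℂ)⁻¹ • (Y * Y) + (6 : ℂ)⁻¹ • (Y * Y * Y) := by
      simp only [Finset.sum_range_succ, Finset.sum_range_zero, zero_add, pow_zero, pow_succ, one_mul,
        Nat.factorial_zero, Nat.factorial_succ, Nat.cast_one, inv_one, one_smul]
      norm_num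
    rw [hps] at h
    have e : exp Y - 1 - Y - (2 : ℂ)⁻¹ • (Y * Y) - (6 : ℂ)⁻¹ • (Y * Y * Y) =
        exp Y - (1 + Y + (2 : ℂ)⁻¹ • (Y * Y) + (6 : ℂ)⁻¹ • (Y * Y * Y)) := by abel
    rwa [e]
  have h2 : HasSum (fun n => ‖Y‖ ^ 4 / 24 * (‖Y‖ ^ n / n !)) (‖Y‖ ^ 4 / 24 * Real.exp ‖Y‖) := by
    rw [Real.exp_eq_exp_ℝ]
    exact (NormedSpace.expSeries_div_hasSum_exp ‖Y‖).mul_left _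
  rw [show ‖Y‖ ^ 4 * Real.exp ‖Y‖ / 24 = ‖Y‖ ^ 4 / 24 * Real.exp ‖Y‖ by ring]
  refine h1'.norm_le_of_bounded h2 fun n => ?_
  have hfac : (24 : ℝ) * n ! ≤ ((n + 4) ! : ℕ) := by
    have h := Nat.le_of_dvd (Nat.factorial_pos _) (Nat.factorial_mul_factorial_dvd_factorial_add n 4)
    have h4 : (4 : ℕ) ! = 24 := rfl
    rw [h4] at h
    exact_mod_cast (by linarith : 24 * n ! ≤ (n + 4) !)
  calc ‖((n + 4) !⁻¹ : ℂ) • Y ^ (n + 4)‖ = ‖Y ^ (n + 4)‖ / ((n + 4) ! : ℕ) := by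
        rw [norm_smul, norm_inv, Complex.norm_natCast, div_eq_inv_mul]
    _ ≤ ‖Y‖ ^ (n + 4) / ((n + 4) ! : ℕ) := by
        gcongr
        exact norm_pow_le' _ (Nat.succ_pos _)
    _ ≤ ‖Y‖ ^ (n + 4) / (24 * n !) :=
        div_le_div_of_nonneg_left (by positivity) (by positivity) hfac
    _ = ‖Y‖ ^ 4 / 24 * (‖Y‖ ^ n / n !) := by ring

/-- **Quadratic cost of the Wilson action to fourth order.**  For a skew-Hermitian `X ∈ M_N(ℂ)` with
`‖X‖_F ≤ 1`: `|N − Re tr e^X − ‖X‖_F²/2| ≤ (N/8) ‖X‖_F⁴` (`Re tr X = Re tr X³ = 0`, `Re tr X² = −‖X‖²`,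
and the fourth-order remainder). [folklore] -/
theorem abs_quadCost_sub_le {X : Matrix (Fin N) (Fin N) ℂ} (hX : Xᴴ = -X) (h1 : ‖X‖ ≤ 1) :
    |((N : ℝ) - (trace (exp X)).re) - ‖X‖ ^ 2 / 2| ≤ (N : ℝ) / 8 * ‖X‖ ^ 4 := by
  set R := exp X - 1 - X - (2 : ℂ)⁻¹ • (X * X) - (6 : ℂ)⁻¹ • (X * X * X) with hR
  have hX3 : (X * X * X)ᴴ = -(X * X * X) := by
    rw [Matrix.conjTranspose_mul, Matrix.conjTranspose_mul, hX]
    noncomm_ring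
  have htr1 : (trace (1 : Matrix (Fin N) (Fin N) ℂ)).re = N := by
    rw [Matrix.trace_one, Fintype.card_fin]; simp
  have hexp : exp X = R + 1 + X + (2 : ℂ)⁻¹ • (X * X) + (6 : ℂ)⁻¹ • (X * X * X) := by
    rw [hR]; abel
  have hid : ((N : ℝ) - (trace (exp X)).re) - ‖X‖ ^ 2 / 2 = -(trace R).re := by
    rw [hexp, ← neg_re_trace_sq_of_skew hX]
    simp only [Matrix.trace_add, Matrix.trace_smul, Complex.add_re, smul_eq_mul, htr1,
      re_trace_eq_zero_of_skew hX, re_trace_eq_zero_of_skew hX3, Complex.mul_re]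
    norm_num
    ring
  rw [hid, abs_neg]
  refine (abs_re_trace_le R).trans ?_
  have hRn : ‖R‖ ≤ ‖X‖ ^ 4 * Real.exp ‖X‖ / 24 := norm_exp_sub_four_le X
  have he : Real.exp ‖X‖ ≤ 3 := (Real.exp_le_exp.2 h1).trans (by
    have := Real.exp_one_lt_d9; linarith)
  have hN : (0 : ℝ) ≤ N := Nat.cast_nonneg N
  have h4 : 0 ≤ ‖X‖ ^ 4 := by positivity
  calc (N : ℝ) * ‖R‖ ≤ N * (‖X‖ ^ 4 * Real.exp ‖X‖ / 24) := by gcongr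
    _ ≤ N * (‖X‖ ^ 4 * 3 / 24) := by gcongr
    _ = (N : ℝ) / 8 * ‖X‖ ^ 4 := by ring

variable {G : Type*} [Group G] [TopologicalSpace G] [CompactSpace G] (ρ : G →* Matrix (Fin N) (Fin N) ℂ)

/-- **(a) in the chart**: `|N − Re tr ρ(ψ a) − ‖a‖²/2| ≤ (N/8)‖a‖⁴` for `‖a‖ ≤ 1`
(`ρ (ψ a) = e^{lieIso a}`, `lieIso` an isometry onto skew-Hermitian matrices). [cite: arXiv160201222, §11] -/
theorem abs_quadCost_expChart_sub_le (hρ : Continuous ρ) (a : EuclideanSpace ℝ (Fin (dimE ρ)))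
    (ha : ‖a‖ ≤ 1) :
    |((N : ℝ) - (trace (ρ (expChart ρ a))).re) - ‖a‖ ^ 2 / 2| ≤ (N : ℝ) / 8 * ‖a‖ ^ 4 := by
  rw [rho_expChart ρ hρ, ← norm_lieIso ρ a]
  exact abs_quadCost_sub_le (conjTranspose_lieIso ρ a) (by rwa [norm_lieIso])

/-! ### (b) Baker–Campbell–Hausdorff to second order in the chart -/

omit [TopologicalSpace G] [CompactSpace G] in
/-- The real scalar `1/2` acts on `M_N(ℂ)` as the complex scalar `2⁻¹`. [folklore] -/
theorem half_real_smul_eq (M : Matrix (Fin N) (Fin N) ℂ) : (1 / 2 : ℝ) • M = (2⁻¹ : ℂ) • M := by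
  rw [RCLike.real_smul_eq_coe_smul (K := ℂ) (1 / 2 : ℝ) M]
  norm_num

/-- **(b) BCH to second order in the exponential chart.**  There is `r₂ > 0` (`r₂ ≤ 1/10`) such that for
`‖a‖, ‖b‖ ≤ r₂` there is `c ∈ ℝ^D` with `ψ a · ψ b = ψ c`, `‖c‖ ≤ 2(‖a‖ + ‖b‖)` and
`‖lieIso c − (lieIso a + lieIso b + ½[lieIso a, lieIso b])‖_F ≤ 5(‖a‖ + ‖b‖)³`.  Proof: `g = ψ a ψ b` has
`‖ρ g − 1‖_F ≤ ‖a‖ + ‖b‖`, so von Neumann's local surjectivity gives `c`; `Z = lieIso c` has `e^Z = e^X e^Y`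
and `‖Z‖ < ln 2`, hence `Z = log(e^X e^Y)`, and Bałaban's (30) bounds `Z − X − Y − ½[X,Y]`.
[cite: Balaban1985Averaging, (30) p.22] [cite: vonNeumann1929, §3] -/
theorem exists_bch_expChart (hρ : Continuous ρ) (hinj : Function.Injective ρ)
    (hU : ∀ g, ρ g ∈ Matrix.unitaryGroup (Fin N) ℂ) :
    ∃ r₂ : ℝ, 0 < r₂ ∧ r₂ ≤ 1 / 10 ∧ ∀ a b : EuclideanSpace ℝ (Fin (dimE ρ)), ‖a‖ ≤ r₂ → ‖b‖ ≤ r₂ →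
      ∃ c : EuclideanSpace ℝ (Fin (dimE ρ)), expChart ρ a * expChart ρ b = expChart ρ c ∧
        ‖c‖ ≤ 2 * (‖a‖ + ‖b‖) ∧
        ‖lieIso ρ c - (lieIso ρ a + lieIso ρ b +
            (1 / 2 : ℝ) • (lieIso ρ a * lieIso ρ b - lieIso ρ b * lieIso ρ a))‖ ≤ 5 * (‖a‖ + ‖b‖) ^ 3 := by
  obtain ⟨r₀, hr₀, hsurj⟩ := exists_chart_radius ρ hρ hinj hU
  refine ⟨min (r₀ / 4) (1 / 10), lt_min (by linarith) (by norm_num), min_le_right _ _,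
    fun a b ha hb => ?_⟩
  have ha0 : ‖a‖ ≤ r₀ / 4 := ha.trans (min_le_left _ _)
  have hb0 : ‖b‖ ≤ r₀ / 4 := hb.trans (min_le_left _ _)
  have ha1 : ‖a‖ ≤ 1 / 10 := ha.trans (min_le_right _ _)
  have hb1 : ‖b‖ ≤ 1 / 10 := hb.trans (min_le_right _ _)
  -- the product is close to `1`
  have hg : ‖ρ (expChart ρ a * expChart ρ b) - 1‖ ≤ ‖a‖ + ‖b‖ :=
    (FemtoCurvatureTwoPoint.DoublingOfRV.norm_rho_mul_sub_one_le ρ hU _ _).trans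
      (add_le_add (norm_rho_expChart_sub_one_le ρ hρ hinj a) (norm_rho_expChart_sub_one_le ρ hρ hinj b))
  have hg0 : ‖ρ (expChart ρ a * expChart ρ b) - 1‖ < r₀ := by linarith
  obtain ⟨c, hc, hcn⟩ := hsurj _ hg0
  refine ⟨c, hc.symm, hcn.trans (by linarith), ?_⟩
  -- `Z = lieIso c` is the logarithm of `e^X e^Y`
  set X := lieIso ρ a with hXdef
  set Y := lieIso ρ b with hYdef
  set Z := lieIso ρ c with hZdef
  have hXn : ‖X‖ = ‖a‖ := norm_lieIso ρ a
  have hYn : ‖Y‖ = ‖b‖ := norm_lieIso ρ b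
  have hZn : ‖Z‖ = ‖c‖ := norm_lieIso ρ c
  have hexpZ : exp Z = exp X * exp Y := by
    rw [hZdef, hXdef, hYdef, ← rho_expChart ρ hρ c, ← rho_expChart ρ hρ a, ← rho_expChart ρ hρ b,
      ← map_mul, hc]
  have hlog2 : (0.6931471803 : ℝ) < Real.log 2 := Real.log_two_gt_d9
  have hZlt : ‖Z‖ < Real.log 2 := by
    rw [hZn]; linarith
  have hmlog : MatrixLog.mlog (exp Z) = Z := B7BlockAvgLog.mlog_exp hZlt
  have hZeq : Z = MatrixLog.mlog (exp X * exp Y) := by rw [← hexpZ, hmlog]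
  have hsum : ‖X‖ + ‖Y‖ ≤ 1 / 5 := by rw [hXn, hYn]; linarith
  have h30 : ‖MatrixLog.mlog (exp X * exp Y) - X - Y - (2⁻¹ : ℂ) • (X * Y - Y * X)‖ ≤
      5 * (‖X‖ ^ 2 * ‖Y‖ + ‖X‖ * ‖Y‖ ^ 2) := B7Eq31BCH.eq30_of_sum_le hsum
  rw [← hZeq, hXn, hYn] at h30
  have hid : Z - (X + Y + (1 / 2 : ℝ) • (X * Y - Y * X)) = Z - X - Y - (2⁻¹ : ℂ) • (X * Y - Y * X) := by
    rw [half_real_smul_eq]; abel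
  rw [hid]
  refine h30.trans ?_
  have ha' := norm_nonneg a
  have hb' := norm_nonneg b
  nlinarith [mul_nonneg ha' hb', mul_nonneg (mul_nonneg ha' hb') (add_nonneg ha' hb'),
    pow_nonneg ha' 3, pow_nonneg hb' 3]

end Summit.QuantumFields.YangMills.Theorems.ColdBoxAllGroups.ExpChart2

end
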